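import Mathlib.Topology.Algebra.Module.FiniteDimension
import Mathlib.Analysis.Calculus.FDeriv.Comp
import Mathlib.Analysis.Calculus.ContDiff.Defs
import Summits.QuantumFields.YangMills.Theorems.BalabanUVNodesK0Stub1PairingsAtExtensions
import HarnessLib

/-!
# K0⁷ STUB 1 (`stub_prop8StepCoP13`), sub-target S4b «the (δ∕δA′)V pieces at objects» — THE CHART BLOCK OF THE SECT. F CAPSTONE AT THE RECORD, part 1:
# **TRANSPOSES BY FORMULA FROM THE DUALISER** — for the pairing (27) `⟨Y, δ⟩ = η^d Σ_b τ(Y_b δ_b)` with a dualiser `ρ` (`τ(ρℓ·X) = ℓX`) and ANY second pairing `B`,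
# every ℂ-linear `T` has the explicit transpose `(Tᵗ X)(b) = η^{−d}·ρ(Z ↦ B X (T(1_b Z)))`, `⟨TᵗX, δ⟩ = B(X, Tδ)`, and `T ↦ Tᵗ` is a continuous linear map;
# hence the capstone's `Qᵗ`, `Hᵗ`, `𝔇(A′)ᵗ` EXIST for ANY `Q`, `H`, `𝔇`, with the adjunction identities `hQt ∕ hHt ∕ hDt` proved and `hDtdiff` inherited from `𝔇`

Cell `pub-ymgap`, width seat `pub-ymgap-k0-s1-w2` g3 (CLAIM-1 (i), bus 2026-08-28 04:54Z).  `--kind proof --supports stmt-QuantumFields-20541 --as helper`;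
count-neutral.  [15] = [Balaban1985Variational].

WHY.  The capstone `K0Stub1SectFWSlotOneLevel.exists_sectF_W_oneLevel ∕ _levOf` (p596653) — Prop. 4 for Sect. F's `W = (δ∕δA′)V` at the Setup torus — takes the
transposes `Qt`, `Ht`, `Dt A′` of the average `Q`, of print's `H` and of the chart derivative `𝔇 A′` for the pairings (27) (`BE`, fine fields) and (66) (`B`, block data)
as DATA, displayed by their adjunction identities `hQt : BE (Qt X) δ = B X (Q δ)`, `hHt : BE Z (H X) = B (Ht Z) X`, `hDt : BE (Dt A′ X) δ = B X (𝔇 A′ δ)`, together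
with the holomorphy `hDtdiff` of `A′ ↦ Dt A′`.  `K0Stub1PairingsAtExtensions.exists_pairings_transposes_flatOps` (p598821) discharged `hQt`, `hHt` for the FLAT operators
by transposing real kernels.  At the record the operators are S2's TRUE linearised average `Qlin = D(chartLog)(0)` (dag-n07-w2 `N07ChartDOfRecord`), dag k0-s1-w1's
corrected right inverse `H` (`K0Stub1RecordAveragingRightInverse`, not a transposed-kernel object) and the `A′`-dependent `𝔇 A′` (dag-n07-w2 `N07ChartDDerivative`):
for these the transposes are best taken BY FORMULA.  Print p. 287 (66): «⟨X, C⟩ = Σ … tr X C … and 𝔇* is the adjoint with respect to these scalar products»;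
p. 288: «Q* … H* … the adjoint operators».  With the dualiser `ρ` of the fibre trace — the capstone's own hypothesis `hρ : τ(ρℓ·X) = ℓX` (g0's
`K0Stub1FibreTraceLetters.exists_fibreLetters`: `ρ_N` for `τ_N = ntr` on `M_N(ℂ)`, `‖ρ_Nℓ‖ ≤ N³‖ℓ‖`) — the functional `δ ↦ B X (Tδ)` is represented bond by bond.

WHAT IS PROVED (sorry-free; no definition; axioms standard).  `𝔸` a finite-dimensional complex normed algebra, `ι` a finite index type, `F` a finite-dimensional
complex normed space.
* §1 ★★ `exists_transposeCLM` — for `BE Y δ = c·Σ_b τ(Y_b δ_b)` (`c ≠ 0`) with a dualiser `ρ` and ANY continuous bilinear `B` on `F`: there is a continuous linear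
  `tr : ((ι → 𝔸) →L F) →L (F →L (ι → 𝔸))` with the FORMULA `tr T X b = c⁻¹ • ρ((B X) ∘ T ∘ 1_b)` and the ADJUNCTION `BE (tr T X) δ = B X (T δ)`;
  `transpose_unique_of_dualiser` — any `Y` with `BE Y δ = B X (T δ)` for all `δ` equals `tr T X` when `τ` is faithful through `ρ`'s partner (uniqueness, optional
  reading: stated under the separating hypothesis `∀ Y, (∀ δ, BE Y δ = 0) → Y = 0`).
* §2 `differentiableOn_transpose_comp`, `contDiffOn_transpose_comp` — `A′ ↦ tr (𝔇 A′)` is as regular as `A′ ↦ 𝔇 A′` (the capstone's `hDtdiff` from the regularity of `𝔇`).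
* §3 ★★ `exists_capstoneTransposes` — AT THE CAPSTONE's LETTERS: for `BE` = (27) on `PBond P 0 → 𝔸` (pv27's `bondPair (L⁻¹)^k d τ`, `hBE` verbatim), the block trace
  pairing `B X X′ = Σ_t τ(X_t X′_t)` on `β → 𝔸`, the dualiser `ρ`, and ANY `Q : fields →L blocks`, `H : blocks →L fields`, `𝔇 : fields → (fields →L blocks)`: there are
  `Qt`, `Ht`, `Dt` with `hQt`, `hHt`, `hDt` (every `A′`) and `DifferentiableOn ℂ 𝔇 s → DifferentiableOn ℂ Dt s` for every `s` — the four structural chart∕transpose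
  hypotheses of `exists_sectF_W_levOf` reduced to the ONE regularity statement «`A′ ↦ 𝔇 A′` holomorphic on the ball» (part 2 of this block: the true chart `D(·)` is
  analytic there).
HONEST SCOPE.  Finite-dimensional linear algebra; no estimate: the transposed LETTERS `q₀` (`Qᵗ`), `h₀` = (46)ᵀ, `θ₀` = (73)ᵀ of the capstone stay displayed (they are
column bounds of kernels, the d = 4 port's ∕ `B11Eq73KernelDecay`'s business); nothing of [15]'s analysis asserted; `stub_prop8StepCoP13` ∕ K0⁷ NOT closed; N07 NOT
discharged; counts unmoved (28∕28 · 5∕27); one finite 𝕋⁴ programme at fixed ε — R4 closes the conditional finite-𝕋⁴ rung `BalabanLadder.UV` only, never the summit; the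
YM mass gap (Clay) is NOT proved by any of this; nothing continuum ∕ ℝ⁴ ∕ OS.  No `sorry`, no `def`, no `instance`, no `notation`.

References: [15] (27) p.282, (66) p.287, p.288 («adjoint operators»), (88)–(90) p.291, Prop. 4 (97)–(98) pp.292–293.
-/

set_option autoImplicit false

noncomputable section

namespace Summit.QuantumFields.YangMills.Theorems.K0Stub1TransposesByDualiser

open scoped BigOperators
open Literature.MathematicalPhysics.QuantumFieldTheory.Balaban1983to89
open B9Eq39Adjoint (bondPair)
open Summit.QuantumFields.YangMills.Theorems.K0Stub1PairingsAtExtensions (bondPair_PBond_eq_sum)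

/-! ## §1  The transpose of a linear map for a dualisable trace pairing, by formula -/

section Generic

variable {ι : Type*} [Fintype ι] [DecidableEq ι]
variable {𝔸 : Type*} [NormedRing 𝔸] [NormedAlgebra ℂ 𝔸] [FiniteDimensional ℂ 𝔸]
variable {F : Type*} [NormedAddCommGroup F] [NormedSpace ℂ F] [FiniteDimensional ℂ F]

/-- ★★ **TRANSPOSES BY FORMULA.**  Let `BE Y δ = c·Σ_b τ(Y_b·δ_b)` on `ι → 𝔸` (`c ≠ 0`; (27) has `c = η^d`), `ρ` a dualiser of `τ` (`τ(ρℓ·X) = ℓX`), and `B` any continuous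
bilinear form on a finite-dimensional `F` ((66) on block data).  Then there is a continuous linear `tr : ((ι → 𝔸) →L F) →L (F →L (ι → 𝔸))` with
`tr T X b = c⁻¹ • ρ((B X) ∘ T ∘ 1_b)` (`1_b` = `ContinuousLinearMap.single`, the field supported at `b`) and `BE (tr T X) δ = B X (T δ)` for all `T, X, δ` — «𝔇* is the
adjoint with respect to these scalar products» (p. 287). [cite: Balaban1985Variational, (27) p.282, (66) p.287, p.288] -/
theorem exists_transposeCLM (c : ℂ) (hc : c ≠ 0) (τ : 𝔸 →L[ℂ] ℂ) (ρ : (𝔸 →L[ℂ] ℂ) →L[ℂ] 𝔸)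
    (hρ : ∀ (ℓ : 𝔸 →L[ℂ] ℂ) (X : 𝔸), τ (ρ ℓ * X) = ℓ X)
    (BE : (ι → 𝔸) →L[ℂ] (ι → 𝔸) →L[ℂ] ℂ) (hBE : ∀ Y δ : ι → 𝔸, BE Y δ = c * ∑ b, τ (Y b * δ b))
    (B : F →L[ℂ] F →L[ℂ] ℂ) :
    ∃ tr : ((ι → 𝔸) →L[ℂ] F) →L[ℂ] (F →L[ℂ] (ι → 𝔸)),
      (∀ (T : (ι → 𝔸) →L[ℂ] F) (X : F) (b : ι),
        tr T X b = c⁻¹ • ρ (((B X).comp T).comp (ContinuousLinearMap.single ℂ (fun _ : ι => 𝔸) b))) ∧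
      (∀ (T : (ι → 𝔸) →L[ℂ] F) (X : F) (δ : ι → 𝔸), BE (tr T X) δ = B X (T δ)) := by
  -- the bilinear map `(T, X) ↦ (b ↦ c⁻¹ • ρ((B X) ∘ T ∘ 1_b))`
  let trₗ : ((ι → 𝔸) →L[ℂ] F) →ₗ[ℂ] F →ₗ[ℂ] (ι → 𝔸) :=
    LinearMap.mk₂ ℂ (fun T X => fun b => c⁻¹ • ρ (((B X).comp T).comp (ContinuousLinearMap.single ℂ (fun _ : ι => 𝔸) b)))
      (fun T T' X => by
        funext b
        simp only [Pi.add_apply, ContinuousLinearMap.comp_add, ContinuousLinearMap.add_comp, map_add, smul_add])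
      (fun z T X => by
        funext b
        simp only [Pi.smul_apply, ContinuousLinearMap.comp_smul, ContinuousLinearMap.smul_comp, map_smul, smul_comm z c⁻¹])
      (fun T X X' => by
        funext b
        simp only [Pi.add_apply, map_add, ContinuousLinearMap.add_comp, smul_add])
      (fun z T X => by
        funext b
        simp only [Pi.smul_apply, map_smul, ContinuousLinearMap.smul_comp, smul_comm z c⁻¹])
  -- continuity is automatic on finite-dimensional spaces
  let tr₁ : ((ι → 𝔸) →L[ℂ] F) →ₗ[ℂ] (F →L[ℂ] (ι → 𝔸)) :=
    (LinearMap.toContinuousLinearMap : (F →ₗ[ℂ] (ι → 𝔸)) ≃ₗ[ℂ] (F →L[ℂ] (ι → 𝔸))).toLinearMap ∘ₗ trₗ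
  refine ⟨LinearMap.toContinuousLinearMap tr₁, fun T X b => rfl, fun T X δ => ?_⟩
  -- the adjunction: `c·Σ_b τ(c⁻¹ρ(ℓ_b)·δ_b) = Σ_b ℓ_b(δ_b) = (B X ∘ T)(Σ_b 1_b δ_b) = B X (T δ)`
  have happ : ∀ b, (LinearMap.toContinuousLinearMap tr₁) T X b
      = c⁻¹ • ρ (((B X).comp T).comp (ContinuousLinearMap.single ℂ (fun _ : ι => 𝔸) b)) := fun b => rfl
  rw [hBE]
  simp_rw [happ, smul_mul_assoc, map_smul, smul_eq_mul, hρ, ← Finset.mul_sum, ← mul_assoc, mul_inv_cancel₀ hc, one_mul]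
  have h := ContinuousLinearMap.sum_comp_single (L := (B X).comp T) (v := δ)
  simpa only [ContinuousLinearMap.comp_apply] using h

omit [Fintype ι] [DecidableEq ι] [FiniteDimensional ℂ 𝔸] [FiniteDimensional ℂ F] in
/-- **UNIQUENESS OF THE TRANSPOSE** when the pairing `BE` separates points on the left (`(∀ δ, BE Y δ = 0) → Y = 0` — for the trace pairing on `M_N(ℂ)` this is the
non-degeneracy of `(X, Y) ↦ tr XY`): any `Y` with `BE Y δ = B X (T δ)` for all `δ` is the transpose value. [folklore] -/
theorem transpose_unique_of_separating (BE : (ι → 𝔸) →L[ℂ] (ι → 𝔸) →L[ℂ] ℂ) (hsep : ∀ Y : ι → 𝔸, (∀ δ, BE Y δ = 0) → Y = 0)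
    (B : F →L[ℂ] F →L[ℂ] ℂ) (tr : ((ι → 𝔸) →L[ℂ] F) →L[ℂ] (F →L[ℂ] (ι → 𝔸)))
    (htr : ∀ (T : (ι → 𝔸) →L[ℂ] F) (X : F) (δ : ι → 𝔸), BE (tr T X) δ = B X (T δ))
    (T : (ι → 𝔸) →L[ℂ] F) (X : F) (Y : ι → 𝔸) (hY : ∀ δ, BE Y δ = B X (T δ)) : Y = tr T X := by
  have h0 : ∀ δ, BE (Y - tr T X) δ = 0 := fun δ => by
    rw [map_sub]
    show BE Y δ - BE (tr T X) δ = 0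
    rw [hY, htr, sub_self]
  exact sub_eq_zero.mp (hsep _ h0)

end Generic

/-! ## §2  Regularity of `A′ ↦ (𝔇 A′)ᵗ` from the regularity of `A′ ↦ 𝔇 A′` -/

section Regularity

variable {E F G : Type*} [NormedAddCommGroup E] [NormedSpace ℂ E] [NormedAddCommGroup F] [NormedSpace ℂ F]
  [NormedAddCommGroup G] [NormedSpace ℂ G]

/-- The capstone's `hDtdiff` from the holomorphy of the chart derivative: if `A′ ↦ 𝔇 A′` is `ℂ`-differentiable on `s`, so is `A′ ↦ tr (𝔇 A′)` for every continuous
linear `tr`. [folklore] -/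
theorem differentiableOn_transpose_comp (tr : F →L[ℂ] G) {𝔇 : E → F} {s : Set E} (h𝔇 : DifferentiableOn ℂ 𝔇 s) :
    DifferentiableOn ℂ (fun A => tr (𝔇 A)) s :=
  tr.differentiable.comp_differentiableOn h𝔇

/-- The same in every class `C^n` (`n ∈ ℕ∞ ∪ {ω}`). [folklore] -/
theorem contDiffOn_transpose_comp (tr : F →L[ℂ] G) {𝔇 : E → F} {s : Set E} {n : WithTop ℕ∞} (h𝔇 : ContDiffOn ℂ n 𝔇 s) :
    ContDiffOn ℂ n (fun A => tr (𝔇 A)) s :=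
  tr.contDiff.comp_contDiffOn h𝔇

/-- From a `C²` (in particular analytic) chart map `D` on an OPEN set: `A′ ↦ tr (fderiv ℂ D A′)` is `ℂ`-differentiable there — the shape in which part 2 of this block
(analyticity of the true chart) feeds the capstone's `hDtdiff` with `𝔇 := fderiv ℂ D`. [folklore] -/
theorem differentiableOn_transpose_fderiv_of_contDiffOn (tr : (E →L[ℂ] F) →L[ℂ] G) {D : E → F} {s : Set E} (hs : IsOpen s)
    (hD : ContDiffOn ℂ 2 D s) : DifferentiableOn ℂ (fun A => tr (fderiv ℂ D A)) s := by
  have h2 : ContDiffOn ℂ (1 + 1) D s := hD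
  have h := ((contDiffOn_succ_iff_fderiv_of_isOpen hs).1 h2).2.2
  exact tr.differentiable.comp_differentiableOn (h.differentiableOn one_ne_zero)

end Regularity

/-! ## §3  ★★ At the capstone's letters: `Qᵗ`, `Hᵗ`, `𝔇(A′)ᵗ` for the pairings (27) ∕ (66), any `Q`, `H`, `𝔇` -/

section Capstone

variable {P : Params}
variable {𝔸 : Type*} [NormedRing 𝔸] [NormedAlgebra ℂ 𝔸] [FiniteDimensional ℂ 𝔸]
variable {β : Type*} [Fintype β] [DecidableEq β]

open scoped Classical in
/-- ★★ **THE CAPSTONE's TRANSPOSES FOR ANY `Q`, `H`, `𝔇`, BY FORMULA.**  Data: the pairing (27) `BE` on `PBond P 0 → 𝔸` in the capstone's letters (`hBE` verbatim: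
pv27's `bondPair (L⁻¹)^k d τ` of the readings), the block trace pairing `B X X′ = Σ_t τ(X_t·X′_t)` on `β → 𝔸`, a dualiser `ρ` of `τ` (`hρ` verbatim), `L ≠ 0`; ANY
continuous linear `Q : fields → blocks`, `H : blocks → fields` and ANY family `𝔇 : fields → (fields →L blocks)`.  THEN there are `Qt`, `Ht` and `Dt : fields → (blocks →L
fields)` with the capstone's `hQt : BE (Qt X) δ = B X (Q δ)`, `hHt : BE Z (H X) = B (Ht Z) X`, `hDt : BE (Dt A′ X) δ = B X (𝔇 A′ δ)` (EVERY `A′`, no ball restriction), the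
regularity transfer `DifferentiableOn ℂ 𝔇 s → DifferentiableOn ℂ Dt s` for every `s` (the capstone's `hDtdiff` from the holomorphy of `𝔇`), and the formulas
`Qt X b = η^{−d}ρ((B X) ∘ Q ∘ 1_b)`, `Dt A′ X b = η^{−d}ρ((B X) ∘ 𝔇 A′ ∘ 1_b)`, `Ht Z t = ρ((BE Z) ∘ H ∘ 1_t)` (`η = L^{−k}`).
[cite: Balaban1985Variational, (27) p.282, (66) p.287, p.288, (88)–(90) p.291] -/
theorem exists_capstoneTransposes (k : ℕ) (hL : (P.L : ℝ) ≠ 0) (τ : 𝔸 →L[ℂ] ℂ) (ρ : (𝔸 →L[ℂ] ℂ) →L[ℂ] 𝔸)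
    (hρ : ∀ (ℓ : 𝔸 →L[ℂ] ℂ) (X : 𝔸), τ (ρ ℓ * X) = ℓ X)
    (BE : (PBond P 0 → 𝔸) →L[ℂ] (PBond P 0 → 𝔸) →L[ℂ] ℂ)
    (hBE : ∀ Y δ : PBond P 0 → 𝔸, BE Y δ = bondPair (((P.L : ℝ))⁻¹ ^ k) P.d (τ : 𝔸 →ₗ[ℂ] ℂ) (fun μ x => Y ⟨x, μ⟩) (fun μ x => δ ⟨x, μ⟩))
    (B : (β → 𝔸) →L[ℂ] (β → 𝔸) →L[ℂ] ℂ) (hB : ∀ X X' : β → 𝔸, B X X' = ∑ t, τ (X t * X' t))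
    (Q : (PBond P 0 → 𝔸) →L[ℂ] (β → 𝔸)) (H : (β → 𝔸) →L[ℂ] (PBond P 0 → 𝔸))
    (𝔇 : (PBond P 0 → 𝔸) → ((PBond P 0 → 𝔸) →L[ℂ] (β → 𝔸))) :
    ∃ (Qt : (β → 𝔸) →L[ℂ] (PBond P 0 → 𝔸)) (Ht : (PBond P 0 → 𝔸) →L[ℂ] (β → 𝔸))
      (Dt : (PBond P 0 → 𝔸) → ((β → 𝔸) →L[ℂ] (PBond P 0 → 𝔸))),
      (∀ X δ, BE (Qt X) δ = B X (Q δ)) ∧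
      (∀ Z X, BE Z (H X) = B (Ht Z) X) ∧
      (∀ A' X δ, BE (Dt A' X) δ = B X (𝔇 A' δ)) ∧
      (∀ s : Set (PBond P 0 → 𝔸), DifferentiableOn ℂ 𝔇 s → DifferentiableOn ℂ Dt s) ∧
      (∀ (X : β → 𝔸) (b : PBond P 0),
        Qt X b = (((((P.L : ℝ))⁻¹ ^ k : ℝ) : ℂ) ^ P.d)⁻¹ • ρ (((B X).comp Q).comp (ContinuousLinearMap.single ℂ (fun _ : PBond P 0 => 𝔸) b))) ∧
      (∀ (A' : PBond P 0 → 𝔸) (X : β → 𝔸) (b : PBond P 0),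
        Dt A' X b = (((((P.L : ℝ))⁻¹ ^ k : ℝ) : ℂ) ^ P.d)⁻¹ • ρ (((B X).comp (𝔇 A')).comp (ContinuousLinearMap.single ℂ (fun _ : PBond P 0 => 𝔸) b))) ∧
      (∀ (Z : PBond P 0 → 𝔸) (t : β), Ht Z t = ρ (((BE Z).comp H).comp (ContinuousLinearMap.single ℂ (fun _ : β => 𝔸) t))) := by
  -- (27) as a bond sum with the constant `c = η^d ≠ 0`
  have hc : ((((((P.L : ℝ))⁻¹ ^ k : ℝ) : ℂ)) ^ P.d) ≠ 0 := by
    apply pow_ne_zero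
    exact_mod_cast pow_ne_zero k (inv_ne_zero hL)
  have hBE' : ∀ Y δ : PBond P 0 → 𝔸, BE Y δ = (((((P.L : ℝ))⁻¹ ^ k : ℝ) : ℂ)) ^ P.d * ∑ b, τ (Y b * δ b) := fun Y δ => by
    rw [hBE]; exact bondPair_PBond_eq_sum _ _ Y δ
  -- transposes of maps `fields → blocks` for (BE, B)
  obtain ⟨tr, htr, hadj⟩ := exists_transposeCLM (ι := PBond P 0) (F := β → 𝔸) _ hc τ ρ hρ BE hBE' B
  -- transposes of maps `blocks → fields` for (B, BE): the block pairing is the case `c = 1`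
  have hB' : ∀ X X' : β → 𝔸, B X X' = (1 : ℂ) * ∑ t, τ (X t * X' t) := fun X X' => by rw [one_mul]; exact hB X X'
  obtain ⟨tr', htr', hadj'⟩ := exists_transposeCLM (ι := β) (F := PBond P 0 → 𝔸) (1 : ℂ) one_ne_zero τ ρ hρ B hB' BE
  refine ⟨tr Q, tr' H, fun A' => tr (𝔇 A'), fun X δ => hadj Q X δ, fun Z X => (hadj' H Z X).symm, fun A' X δ => hadj (𝔇 A') X δ,
    fun s h𝔇 => differentiableOn_transpose_comp (E := PBond P 0 → 𝔸) (F := (PBond P 0 → 𝔸) →L[ℂ] (β → 𝔸))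
      (G := (β → 𝔸) →L[ℂ] (PBond P 0 → 𝔸)) tr h𝔇, fun X b => htr Q X b, fun A' X b => htr (𝔇 A') X b, fun Z t => ?_⟩
  rw [htr', inv_one, one_smul]

end Capstone

end Summit.QuantumFields.YangMills.Theorems.K0Stub1TransposesByDualiser

end
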